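import Summits.QuantumFields.BalabanUV.Beta.FP.MarginalUniqueness
import Literature.MathematicalPhysics.QuantumFieldTheory.Balaban1983to89.Beta.SquareTable

/-!
# `BalabanUV.Beta.FP.BubbleGermValue` — road «FP» for binder row D1, leaf H2-b-ALG: THE x-SPACE ONE-LOOP BUBBLE OF TWO CUBIC GERMS ON FREE LEGS
# IS THE BACKGROUND-FIELD VALUE `4T − 2S` (gluon) `+ S` (ghost) — an3's LABELLED sector coefficients `8N² ∕ −2N²` REPRODUCED FROM THE VERTEX GERMS.

HONEST DEPENDENCY (page 1, mandatory): continuum YM on T⁴ ⇐ BetaPertH ∧ nine spine estimates (0/9 proved); BetaPertH ⇐ (D1) ∧ (D4) ∧ CAP+tail;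
G-an2-4 gates asym, D1 and NE2/3/4.  HONEST FRAMING (cell contract, verbatim): «discharging `BetaPertH` makes Bałaban's UV stability UNCONDITIONAL —
a real constructive-QFT result; it is NOT the continuum limit and NOT the Clay problem.»  THIS MODULE DISCHARGES NOTHING of the wall: FINITE TENSOR
ALGEBRA over `Fin 4` (Kronecker deltas of `FP/MarginalUniqueness`) times the closed-form rational legs `ℓ₀ = |z|⁻²`, `∂ℓ₀`, `∂∂ℓ₀` of `BubbleTransfer`
(`invSq ∕ d1InvSq ∕ hessInvSq`) — no lattice, no limit, no estimate; 0 `def … : Prop`, nothing cited, 0 sorry; NOT D1, NOT BetaPertH, NOT continuum, NOT Clay.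
ABSOLUTE RULE (cell charter, verbatim): «No internally-minted statement may enter as a cited fact. Every hypothesis is either kernel-proved in this package or a
verbatim quotation of a PUBLISHED theorem with page reference. The manuscript(s) under audit are NOT citable for their own disputed steps — they are the thing
under adjudication; programme-internal (2001/route/tribunal) claims are never citable.»  Every statement below is an identity of explicit finite sums.

ENCODING (as in `FP/MarginalUniqueness`: `L μ ν λ κ i` = coefficient of `B¹_μ B²_ν B³_λ (k_i)_κ`, `k₀ = p`, `k₁ = q`, `r` eliminated); HERE legs 1, 2 are the
two QUANTUM legs and leg 3 the BACKGROUND leg, so a germ's x-space current is `J_λ[L] = Σ_{μνκ} L μνλκ0·(∂_κQ¹_μ)Q²_ν + L μνλκ1·Q¹_μ(∂_κQ²_ν)` (colour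
`f^{abc}` stripped); the BUBBLE `⟨J_λ[L](z) J_{λ′}[L′](0)⟩` on free legs `c₄ℓ₀δ` has two Wick channels — DIRECT (1 ↔ 1′, 2 ↔ 2′; colour `f^{abc}f^{a′bc} = +N`)
and CROSSED (1 ↔ 2′, 2 ↔ 1′; colour `−N`) — and a momentum label puts `∂_κ` on the line through its leg, at `z` (`+∂`) or at `0` (`∂^{(0)}ℓ₀(z − 0) = −∂ℓ₀`):
both labels on ONE line ↦ `−ℓ₀·∂_κ∂_{κ′}ℓ₀`, one on EACH ↦ `−∂_κℓ₀·∂_{κ′}ℓ₀` (`legW ∕ legWx`).  Every `def` below is [our object] (each docstring says what it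
encodes); every theorem is [folklore] finite algebra.  HEADLINE (`z ≠ 0`, ALL `λ λ′`, `T = transverse`, `S = scalarBubble`): **`bubble bfGerm bfGerm =
4·gluonBubble`** (`¼·bubble = 4T − 2S`, the `¼` being the Lagrangian's `(g∕2)²`), **`ghostLoop = ghostBubble`** (`= S`), `¼·bubble + ghostLoop = bfBubble`
(= DR (14) at d = 4), the JUNCTION **`2N²c₄²·(¼·bubble + ghostLoop) = contBubble univ (bfCoeff N) (bfP h) (bfQ h)`** (`λ ≠ λ′`; `SquareTable`) and `hval`
with `κ = kappaBal N` — an3's LABELLED `8N² = 2N²·4` (from `4T`) and `−2N² = 2N²·(−2 + 1)` (gluon `−2S` + ghost `+S`) now follow from the vertex germs; the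
BOSE LEMMA (`Anti12 L′ → crossed = −direct`); the closed form of the direct channel for ANY two isotropic germs (`bubbleDirect_pat`); and LOCATED TIGHTNESS:
`¼·bubble (c·ymGerm + s·sliceGerm) = covFamily (−20c² − 20cs) (44c² + 32cs + 4s²)` is divergence-free **iff `s = c`** (`ymGerm` alone: `(11∕6)T + 2δ∕r2³`).
WHAT IT IS NOT: it does not identify the perfect theory's BQQ jet with `cQ·bfGerm` (H2-G = `MarginalUniquenessWard(Minimal)` + the slice ruling H2-DESIGN §5 +
H2-GH) nor its legs with `c₄δ∕‖z‖²` (H2-P-KER); it is the finite algebra those rows feed.  ENGINE: exact-rational evaluation at 11 lattice points agrees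
(`HOME/t4/b2b-balaban-t4-ne9-formalise-leaf-03/g27/bubble_exact.py`).  Provenance: b2b-balaban-t4-ne9-formalise-leaf-03 gen 27, 2026-08-20, row H2-b-ALG (R-FP-17).
-/

namespace Summit.QuantumFields.BalabanUV.Beta.FP.BubbleGermValue

open Finset
open scoped BigOperators
open Summit.QuantumFields.BalabanUV.Beta.FP.MarginalUniqueness
open Literature.MathematicalPhysics.QuantumFieldTheory.Balaban1983to89.Beta.TransverseStructure
open Literature.MathematicalPhysics.QuantumFieldTheory.Balaban1983to89.Beta.TransverseLink
open Literature.MathematicalPhysics.QuantumFieldTheory.Balaban1983to89.Beta.BubbleTransfer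
open Literature.MathematicalPhysics.QuantumFieldTheory.Balaban1983to89.Beta.LeadingCoefficient
open Literature.MathematicalPhysics.QuantumFieldTheory.Balaban1983to89.Beta.SquareTable

noncomputable section

/-! ## §1 Kronecker-delta contraction lemmas over `Fin 4` -/

/-- [folklore] `Σ_μ δ_{μa} F(μ) = F(a)`. -/
theorem sum_δ_mul (a : Idx) (F : Idx → ℝ) : ∑ μ, δ μ a * F μ = F a := by
  rw [Finset.sum_eq_single a (fun b _ hb => by simp [δ, hb]) (fun h => absurd (Finset.mem_univ a) h)]; simp [δ]

/-- [folklore] `Σ_μ δ_{aμ} F(μ) = F(a)`. -/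
theorem sum_δ_mul' (a : Idx) (F : Idx → ℝ) : ∑ μ, δ a μ * F μ = F a := by
  simp_rw [δ_comm a]; exact sum_δ_mul a F

/-- [folklore] `Σ_{μν} δ_{μν} δ_{μν} = 4` (the dimension). -/
theorem sum_δμν_sq : ∑ μ : Idx, ∑ ν : Idx, δ μ ν * δ μ ν = 4 := by
  simp_rw [sum_δ_mul']
  simp

/-- [folklore] `Σ_{μν} δ_{μν} δ_{μc} δ_{νd} = δ_{cd}`. -/
theorem sum_δμν_mul (c d : Idx) : ∑ μ : Idx, ∑ ν : Idx, δ μ ν * (δ μ c * δ ν d) = δ c d := by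
  simp_rw [sum_δ_mul', sum_δ_mul]

/-- [folklore] `Σ_{μν} (δ_{μa} δ_{νb})(δ_{μc} δ_{νd}) = δ_{ac} δ_{bd}`. -/
theorem sum_δδ_δδ (a b c d : Idx) : ∑ μ : Idx, ∑ ν : Idx, (δ μ a * δ ν b) * (δ μ c * δ ν d) = δ a c * δ b d := by
  have h : ∀ μ ν : Idx, (δ μ a * δ ν b) * (δ μ c * δ ν d) = δ μ a * (δ ν b * (δ μ c * δ ν d)) := fun μ ν => by ring
  simp_rw [h, ← Finset.mul_sum, sum_δ_mul]

/-- [folklore] `Σ_{κκ′} δ_{aκ} δ_{bκ′} F(κ,κ′) = F(a,b)`. -/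
theorem sum_δδ_F (a b : Idx) (F : Idx → Idx → ℝ) : ∑ κ, ∑ κ', δ a κ * δ b κ' * F κ κ' = F a b := by
  have h : ∀ κ κ' : Idx, δ a κ * δ b κ' * F κ κ' = δ a κ * (δ b κ' * F κ κ') := fun κ κ' => by ring
  simp_rw [h, ← Finset.mul_sum, sum_δ_mul']

/-- [folklore] `Σ_{κκ′} δ_{aκ′} δ_{κb} F(κ,κ′) = F(b,a)`. -/
theorem sum_δδ_F' (a b : Idx) (F : Idx → Idx → ℝ) : ∑ κ, ∑ κ', δ a κ' * δ κ b * F κ κ' = F b a := by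
  have h : ∀ κ κ' : Idx, δ a κ' * δ κ b * F κ κ' = δ κ b * (δ a κ' * F κ κ') := fun κ κ' => by ring
  simp_rw [h, ← Finset.mul_sum, sum_δ_mul', sum_δ_mul]

/-- [folklore] `Σ_{κκ′} δ_{κκ′} F(κ,κ′) = Σ_κ F(κ,κ)`. -/
theorem sum_diag_F (F : Idx → Idx → ℝ) : ∑ κ, ∑ κ', δ κ κ' * F κ κ' = ∑ κ, F κ κ := by
  simp_rw [sum_δ_mul']

/-! ## §2 The germs: slice, background-Feynman, isotropic pattern germs; Bose antisymmetry under 1 ↔ 2 -/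

/-- [our object] The sign of a momentum label: `+1` for `p` (`i = 0`), `−1` for `q` (`i = 1`). -/
def sgn (i : Fin 2) : ℝ := if i = 0 then 1 else -1

/-- [our object] `sgn 0 = 1`, `sgn 1 = −1`. -/
@[simp] theorem sgn_vals : sgn 0 = 1 ∧ sgn 1 = -1 := by simp [sgn]

/-- [our object] **The slice germ**: the `B·Q·Q` jet of the background-covariant Feynman gauge-fixing term `½(D^B_μ Q_μ)²` (ξ = 1), i.e. the vertex
`f^{abc}(∂_κ Q^b_κ)(B^a_λ Q^c_λ)` with legs 1, 2 quantum and leg 3 background: p-part `δ_{μκ}δ_{νλ}`, q-part `−δ_{νκ}δ_{μλ}`. -/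
def sliceGerm : CubicGerm := fun μ ν lam κ i => if i = 0 then δ μ κ * δ ν lam else -(δ ν κ * δ μ lam)

/-- [our object] **The background-Feynman cubic germ** `bfGerm = ymGerm + sliceGerm` (Abbott's BQQ vertex at ξ = 1, colour stripped; the Lagrangian
`¼F² + ½(D^B·Q)²` expanded to order `B·Q·Q` has the current `−(g∕2)·J[bfGerm]`). -/
def bfGerm : CubicGerm := fun μ ν lam κ i => ymGerm μ ν lam κ i + sliceGerm μ ν lam κ i

/-- [our object] **The general isotropic cubic germ** with pattern coefficients `α β γ : Fin 2 → ℝ`: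
`α_i·δ_{μν}δ_{λκ} + β_i·δ_{μκ}δ_{νλ} + γ_i·δ_{μλ}δ_{νκ}`. -/
def patGerm (α β γ : Fin 2 → ℝ) : CubicGerm := fun μ ν lam κ i =>
  α i * (δ μ ν * δ lam κ) + β i * (δ μ κ * δ ν lam) + γ i * (δ μ lam * δ ν κ)

/-- [our object] The two-parameter family `c·ymGerm + s·sliceGerm`. -/
def famGerm (c s : ℝ) : CubicGerm := fun μ ν lam κ i => c * ymGerm μ ν lam κ i + s * sliceGerm μ ν lam κ i

/-- [our object] pattern coefficients of `famGerm c s`: `α = (c, −c)`. -/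
def famα (c : ℝ) : Fin 2 → ℝ := fun i => sgn i * c
/-- [our object] pattern coefficients of `famGerm c s`: `β = (c + s, 2c)`. -/
def famβ (c s : ℝ) : Fin 2 → ℝ := fun i => if i = 0 then c + s else 2 * c
/-- [our object] pattern coefficients of `famGerm c s`: `γ = (−2c, −(c + s))`. -/
def famγ (c s : ℝ) : Fin 2 → ℝ := fun i => if i = 0 then -(2 * c) else -(c + s)

/-- [our object] `famGerm c s` IS the isotropic germ with coefficients `(famα c, famβ c s, famγ c s)`. -/
theorem famGerm_eq_pat (c s : ℝ) (μ ν lam κ : Idx) (i : Fin 2) :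
    famGerm c s μ ν lam κ i = patGerm (famα c) (famβ c s) (famγ c s) μ ν lam κ i := by
  have h1 := δ_comm lam μ
  have h2 := δ_comm ν lam
  fin_cases i <;> simp [famGerm, patGerm, famα, famβ, famγ, ymGerm, sliceGerm, sgn] <;> rw [h1] <;> ring

/-- [our object] `bfGerm = famGerm 1 1`. -/
theorem bfGerm_eq_fam : bfGerm = famGerm 1 1 := by
  funext μ ν lam κ i; simp [bfGerm, famGerm]

/-- [our object] `ymGerm = famGerm 1 0`. -/
theorem ymGerm_eq_fam : ymGerm = famGerm 1 0 := by
  funext μ ν lam κ i; simp [famGerm]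

/-- [our object] `bfGerm` as an isotropic pattern germ: `sgn_i·δ_{μν}δ_{λκ} + 2·δ_{μκ}δ_{νλ} − 2·δ_{μλ}δ_{νκ}`. -/
theorem bfGerm_apply (μ ν lam κ : Idx) (i : Fin 2) :
    bfGerm μ ν lam κ i = sgn i * (δ μ ν * δ lam κ) + 2 * (δ μ κ * δ ν lam) - 2 * (δ μ lam * δ ν κ) := by
  rw [bfGerm_eq_fam, famGerm_eq_pat, patGerm]
  fin_cases i <;> simp [famα, famβ, famγ] <;> ring

/-- [our object] The slice germ is Bose-antisymmetric under the exchange of the two quantum legs. -/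
theorem sliceGerm_anti12 : Anti12 sliceGerm := by
  constructor <;> intro μ ν lam κ <;> simp [sliceGerm]

/-- [our object] `famGerm c s` is Bose-antisymmetric under 1 ↔ 2. -/
theorem famGerm_anti12 (c s : ℝ) : Anti12 (famGerm c s) := by
  constructor <;> intro μ ν lam κ <;> simp only [famGerm]
  · rw [ymGerm_anti12.1, sliceGerm_anti12.1]; ring
  · rw [ymGerm_anti12.2, sliceGerm_anti12.2]; ring

/-- [our object] `bfGerm` is Bose-antisymmetric under 1 ↔ 2. -/
theorem bfGerm_anti12 : Anti12 bfGerm := by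
  rw [bfGerm_eq_fam]; exact famGerm_anti12 1 1

/-! ## §3 The x-space contraction: leg weights, the two Wick channels, the ghost loop; Gram tables; the Bose lemma -/

/-- [our object] Leg weights of the DIRECT channel on the free legs `ℓ₀ = |z|⁻²`: both derivatives on one line (`i = i′`) ↦ `−ℓ₀·∂_κ∂_{κ′}ℓ₀`,
one on each ↦ `−∂_κℓ₀·∂_{κ′}ℓ₀` (the sign is `∂^{(0)} ℓ₀(z − 0) = −∂ℓ₀(z)`). -/
def legW (x : E4) (i i' : Fin 2) (κ κ' : Idx) : ℝ :=
  if i = i' then -(invSq x * hessInvSq κ κ' x) else -(d1InvSq κ x * d1InvSq κ' x)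

/-- [our object] Leg weights of the CROSSED channel: both derivatives on one line iff the labels differ. -/
def legWx (x : E4) (i i' : Fin 2) (κ κ' : Idx) : ℝ :=
  if i = i' then -(d1InvSq κ x * d1InvSq κ' x) else -(invSq x * hessInvSq κ κ' x)

/-- [our object] **Direct Wick channel** of two cubic germs (leg 1 ↔ 1′, 2 ↔ 2′; colour `+N` stripped): quantum indices contracted first, then the
derivative placement. -/
def bubbleDirect (L L' : CubicGerm) (lam lam' : Idx) (x : E4) : ℝ :=
  ∑ i, ∑ i', ∑ κ, ∑ κ', (∑ μ, ∑ ν, L μ ν lam κ i * L' μ ν lam' κ' i') * legW x i i' κ κ'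

/-- [our object] **Crossed Wick channel** (leg 1 ↔ 2′, 2 ↔ 1′; colour `−N` stripped — the minus sign is applied in `bubble`). -/
def bubbleCrossed (L L' : CubicGerm) (lam lam' : Idx) (x : E4) : ℝ :=
  ∑ i, ∑ i', ∑ κ, ∑ κ', (∑ μ, ∑ ν, L μ ν lam κ i * L' ν μ lam' κ' i') * legWx x i i' κ κ'

/-- [our object] **The one-loop bubble of two cubic germs** `⟨J_λ[L](z) J_{λ′}[L′](0)⟩ ∕ (N·c₄²)` on free unit legs: direct channel minus crossed channel. -/
def bubble (L L' : CubicGerm) (lam lam' : Idx) (x : E4) : ℝ :=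
  bubbleDirect L L' lam lam' x - bubbleCrossed L L' lam lam' x

/-- [our object] **The ghost cubic germ** (scalar adjoint legs: leg 1 = `c̄` with momentum `p`, leg 2 = `c` with momentum `q`, leg 3 = `B_λ`):
`Φ_gh = B_λ (p − q)_λ c̄ c`, i.e. `+δ_{λκ}` on the `p`-label, `−δ_{λκ}` on the `q`-label. -/
def ghostGerm (lam κ : Idx) (i : Fin 2) : ℝ := sgn i * δ lam κ

/-- [our object] **The ghost loop** `⟨K_λ(z) K_{λ′}(0)⟩ ∕ (N·c₄²)`: its only Wick channel is `c(z) ↔ c̄(0)`, `c̄(z) ↔ c(0)` (crossed weights); the colour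
factor `−N` and the Fermi-loop sign `−1` multiply to `+N`, stripped. -/
def ghostLoop (lam lam' : Idx) (x : E4) : ℝ :=
  ∑ i, ∑ i', ∑ κ, ∑ κ', ghostGerm lam κ i * ghostGerm lam' κ' i' * legWx x i i' κ κ'

/-- [folklore] **GRAM TABLE of two isotropic germs over the quantum indices**:
`Σ_{μν} pat(α,β,γ)_{μνλκ,i} · pat(α′,β′,γ′)_{μνλ′κ′,i′} = A·δ_{λκ}δ_{λ′κ′} + B·δ_{λλ′}δ_{κκ′} + C·δ_{λκ′}δ_{κλ′}` with
`A = 4α_iα′_{i′} + α_i(β′_{i′} + γ′_{i′}) + α′_{i′}(β_i + γ_i)`, `B = β_iβ′_{i′} + γ_iγ′_{i′}`, `C = β_iγ′_{i′} + γ_iβ′_{i′}`. -/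
theorem gram_pat (α β γ α' β' γ' : Fin 2 → ℝ) (lam κ lam' κ' : Idx) (i i' : Fin 2) :
    ∑ μ, ∑ ν, patGerm α β γ μ ν lam κ i * patGerm α' β' γ' μ ν lam' κ' i' =
      (4 * (α i * α' i') + α i * (β' i' + γ' i') + α' i' * (β i + γ i)) * (δ lam κ * δ lam' κ')
        + (β i * β' i' + γ i * γ' i') * (δ lam lam' * δ κ κ') + (β i * γ' i' + γ i * β' i') * (δ lam κ' * δ κ lam') := by
  have h : ∀ μ ν : Idx, patGerm α β γ μ ν lam κ i * patGerm α' β' γ' μ ν lam' κ' i' =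
      (α i * α' i' * (δ lam κ * δ lam' κ')) * (δ μ ν * δ μ ν)
      + (α i * β' i' * δ lam κ) * (δ μ ν * (δ μ κ' * δ ν lam'))
      + (α i * γ' i' * δ lam κ) * (δ μ ν * (δ μ lam' * δ ν κ'))
      + (β i * α' i' * δ lam' κ') * (δ μ ν * (δ μ κ * δ ν lam))
      + (β i * β' i') * ((δ μ κ * δ ν lam) * (δ μ κ' * δ ν lam'))
      + (β i * γ' i') * ((δ μ κ * δ ν lam) * (δ μ lam' * δ ν κ'))
      + (γ i * α' i' * δ lam' κ') * (δ μ ν * (δ μ lam * δ ν κ))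
      + (γ i * β' i') * ((δ μ lam * δ ν κ) * (δ μ κ' * δ ν lam'))
      + (γ i * γ' i') * ((δ μ lam * δ ν κ) * (δ μ lam' * δ ν κ')) := by
    intro μ ν; simp only [patGerm]; ring
  simp_rw [h]
  simp only [Finset.sum_add_distrib, ← Finset.mul_sum]
  rw [sum_δμν_sq, sum_δμν_mul, sum_δμν_mul, sum_δμν_mul, sum_δδ_δδ, sum_δδ_δδ, sum_δμν_mul, sum_δδ_δδ, sum_δδ_δδ,
    δ_comm κ' lam', δ_comm κ lam]
  ring

/-- [folklore] Crossed Gram sum = minus the direct Gram sum with the second label flipped, for a Bose-antisymmetric second germ (`q`-label). -/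
theorem gram_cross_zero {L L' : CubicGerm} (h : Anti12 L') (lam κ lam' κ' : Idx) (i : Fin 2) :
    ∑ μ, ∑ ν, L μ ν lam κ i * L' ν μ lam' κ' 0 = -∑ μ, ∑ ν, L μ ν lam κ i * L' μ ν lam' κ' 1 := by
  rw [← Finset.sum_neg_distrib]; refine Finset.sum_congr rfl fun μ _ => ?_
  rw [← Finset.sum_neg_distrib]; refine Finset.sum_congr rfl fun ν _ => ?_
  rw [h.2 μ ν lam' κ']; ring

/-- [folklore] idem, `p`-label. -/
theorem gram_cross_one {L L' : CubicGerm} (h : Anti12 L') (lam κ lam' κ' : Idx) (i : Fin 2) :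
    ∑ μ, ∑ ν, L μ ν lam κ i * L' ν μ lam' κ' 1 = -∑ μ, ∑ ν, L μ ν lam κ i * L' μ ν lam' κ' 0 := by
  rw [← Finset.sum_neg_distrib]; refine Finset.sum_congr rfl fun μ _ => ?_
  rw [← Finset.sum_neg_distrib]; refine Finset.sum_congr rfl fun ν _ => ?_
  rw [h.1 μ ν lam' κ']; ring

/-- [our object] crossed weight at second label `0` = direct weight at second label `1`. -/
theorem legWx_zero (x : E4) (i : Fin 2) (κ κ' : Idx) : legWx x i 0 κ κ' = legW x i 1 κ κ' := by
  fin_cases i <;> simp [legW, legWx]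

/-- [our object] crossed weight at second label `1` = direct weight at second label `0`. -/
theorem legWx_one (x : E4) (i : Fin 2) (κ κ' : Idx) : legWx x i 1 κ κ' = legW x i 0 κ κ' := by
  fin_cases i <;> simp [legW, legWx]

/-- [folklore] **BOSE LEMMA**: for a second germ antisymmetric under the exchange of its quantum legs, the crossed Wick channel equals MINUS the
direct one — so with the colour signs `+N ∕ −N` the two channels contribute equally: `bubble L L′ = 2·bubbleDirect L L′`. -/
theorem bubbleCrossed_eq_neg_direct {L L' : CubicGerm} (h : Anti12 L') (lam lam' : Idx) (x : E4) :
    bubbleCrossed L L' lam lam' x = -bubbleDirect L L' lam lam' x := by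
  unfold bubbleCrossed bubbleDirect
  simp only [Fin.sum_univ_two, gram_cross_zero h, gram_cross_one h, legWx_zero, legWx_one, neg_mul, Finset.sum_neg_distrib,
    Finset.sum_add_distrib]
  ring

/-! ## §4 The direct channel of two isotropic germs in closed form -/

/-- [folklore] The quantum-index contraction followed by the `κ κ′` contraction, at fixed momentum labels. -/
theorem inner_pat (α β γ α' β' γ' : Fin 2 → ℝ) (lam lam' : Idx) (i i' : Fin 2) (x : E4) :
    ∑ κ, ∑ κ', (∑ μ, ∑ ν, patGerm α β γ μ ν lam κ i * patGerm α' β' γ' μ ν lam' κ' i') * legW x i i' κ κ' =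
      (4 * (α i * α' i') + α i * (β' i' + γ' i') + α' i' * (β i + γ i)) * legW x i i' lam lam'
        + (β i * β' i' + γ i * γ' i') * (δ lam lam' * ∑ κ, legW x i i' κ κ)
        + (β i * γ' i' + γ i * β' i') * legW x i i' lam' lam := by
  simp_rw [gram_pat]
  have h : ∀ κ κ' : Idx,
      ((4 * (α i * α' i') + α i * (β' i' + γ' i') + α' i' * (β i + γ i)) * (δ lam κ * δ lam' κ')
        + (β i * β' i' + γ i * γ' i') * (δ lam lam' * δ κ κ') + (β i * γ' i' + γ i * β' i') * (δ lam κ' * δ κ lam')) * legW x i i' κ κ'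
      = (4 * (α i * α' i') + α i * (β' i' + γ' i') + α' i' * (β i + γ i)) * (δ lam κ * δ lam' κ' * legW x i i' κ κ')
        + ((β i * β' i' + γ i * γ' i') * δ lam lam') * (δ κ κ' * legW x i i' κ κ')
        + (β i * γ' i' + γ i * β' i') * (δ lam κ' * δ κ lam' * legW x i i' κ κ') := by
    intro κ κ'; ring
  simp_rw [h]
  simp only [Finset.sum_add_distrib, ← Finset.mul_sum]
  rw [sum_δδ_F, sum_diag_F, sum_δδ_F']
  ring

/-- [folklore] The trace of the direct weights: `Σ_κ legW z i i′ κ κ = 0` if `i = i′` (harmonicity of `ℓ₀`, `lap_invSq_zero`), `= −Σ_κ(∂_κℓ₀)²` otherwise. -/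
theorem sum_legW_diag {x : E4} (hx : x ≠ 0) (i i' : Fin 2) :
    ∑ κ, legW x i i' κ κ = if i = i' then 0 else -∑ κ, d1InvSq κ x ^ 2 := by
  by_cases h : i = i'
  · simp only [legW, h, if_true, Finset.sum_neg_distrib, ← Finset.mul_sum, lap_invSq_zero hx, mul_zero, neg_zero]
  · simp only [legW, h, if_false, Finset.sum_neg_distrib, pow_two]

/-- [folklore] **THE DIRECT CHANNEL OF TWO ISOTROPIC GERMS, CLOSED FORM** (`z ≠ 0`): with `A_{ii′}, B_{ii′}, C_{ii′}` the Gram coefficients of `gram_pat`,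
`bubbleDirect = −(A₀₀ + A₁₁)·ℓ₀∂_λ∂_{λ′}ℓ₀ − (C₀₀ + C₁₁)·ℓ₀∂_{λ′}∂_λℓ₀ − (A₀₁ + A₁₀)·∂_λℓ₀∂_{λ′}ℓ₀ − (C₀₁ + C₁₀)·∂_{λ′}ℓ₀∂_λℓ₀ − (B₀₁ + B₁₀)·δ_{λλ′}Σ(∂ℓ₀)²`
(the `B₀₀ + B₁₁` term multiplies `ℓ₀Δℓ₀ = 0`). -/
theorem bubbleDirect_pat (α β γ α' β' γ' : Fin 2 → ℝ) (lam lam' : Idx) {x : E4} (hx : x ≠ 0) :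
    bubbleDirect (patGerm α β γ) (patGerm α' β' γ') lam lam' x =
      -((4 * (α 0 * α' 0) + α 0 * (β' 0 + γ' 0) + α' 0 * (β 0 + γ 0))
          + (4 * (α 1 * α' 1) + α 1 * (β' 1 + γ' 1) + α' 1 * (β 1 + γ 1))) * (invSq x * hessInvSq lam lam' x)
      - ((β 0 * γ' 0 + γ 0 * β' 0) + (β 1 * γ' 1 + γ 1 * β' 1)) * (invSq x * hessInvSq lam' lam x)
      - ((4 * (α 0 * α' 1) + α 0 * (β' 1 + γ' 1) + α' 1 * (β 0 + γ 0))
          + (4 * (α 1 * α' 0) + α 1 * (β' 0 + γ' 0) + α' 0 * (β 1 + γ 1))) * (d1InvSq lam x * d1InvSq lam' x)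
      - ((β 0 * γ' 1 + γ 0 * β' 1) + (β 1 * γ' 0 + γ 1 * β' 0)) * (d1InvSq lam' x * d1InvSq lam x)
      - ((β 0 * β' 1 + γ 0 * γ' 1) + (β 1 * β' 0 + γ 1 * γ' 0)) * (δ lam lam' * ∑ κ, d1InvSq κ x ^ 2) := by
  unfold bubbleDirect
  simp_rw [inner_pat, sum_legW_diag hx]
  simp only [Fin.sum_univ_two, legW, Fin.isValue, if_true, one_ne_zero, zero_ne_one, if_false]
  ring

/-! ## §5 THE VALUES: gluon `4T − 2S`, ghost `S`, their sum `bfBubble`, and the junction with an3's realised table -/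

/-- [folklore] **THE BUBBLE OF THE TWO-PARAMETER FAMILY** `c·ymGerm + s·sliceGerm` (both channels = twice the direct one, `bubbleDirect_pat` at its data). -/
theorem bubble_fam (c s : ℝ) (lam lam' : Idx) {x : E4} (hx : x ≠ 0) :
    bubble (famGerm c s) (famGerm c s) lam lam' x =
      2 * ((4 * c ^ 2 + 4 * c * s) * (invSq x * hessInvSq lam lam' x) + (14 * c ^ 2 + 8 * c * s + 2 * s ^ 2) * (d1InvSq lam x * d1InvSq lam' x)
        - 8 * c * (c + s) * (δ lam lam' * ∑ κ, d1InvSq κ x ^ 2)) := by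
  have e : famGerm c s = patGerm (famα c) (famβ c s) (famγ c s) := by
    funext μ ν lam κ i; exact famGerm_eq_pat c s μ ν lam κ i
  rw [bubble, bubbleCrossed_eq_neg_direct (famGerm_anti12 c s), e, bubbleDirect_pat _ _ _ _ _ _ lam lam' hx, hessInvSq_symm lam' lam,
    mul_comm (d1InvSq lam' x) (d1InvSq lam x)]
  simp [famα, famβ, famγ]
  ring

/-- [folklore] **THE GLUON LOOP**: `bubble bfGerm bfGerm λ λ′ z = 4·gluonBubble λ λ′ z` (`= 4·(4T − 2S) = (40∕3)·T`) at every `z ≠ 0`, ALL `λ λ′` — with the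
Lagrangian's `J = −(g∕2)·J[bfGerm]`, `¼·bubble = gluonBubble`: the background-Feynman gluon loop (gluon half of DR (14) at `d = 4`) DERIVED from the germ. -/
theorem bubble_bfGerm (lam lam' : Idx) {x : E4} (hx : x ≠ 0) :
    bubble bfGerm bfGerm lam lam' x = 4 * gluonBubble lam lam' x := by
  rw [bfGerm_eq_fam, bubble_fam 1 1 lam lam' hx, gluonBubble, scalarBubble, transverse_eq_legs lam lam' hx,
    hessInvQuartic_eq_legs]
  unfold δ; split_ifs <;> ring

/-- [folklore] **THE GLUON LOOP, Lagrangian normalisation**: `¼·bubble bfGerm bfGerm = gluonBubble = 4T − 2S`. -/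
theorem quarter_bubble_bfGerm (lam lam' : Idx) {x : E4} (hx : x ≠ 0) :
    (1 / 4 : ℝ) * bubble bfGerm bfGerm lam lam' x = gluonBubble lam lam' x := by
  rw [bubble_bfGerm lam lam' hx]; ring

/-- [folklore] **THE GHOST LOOP**: `ghostLoop λ λ′ z = ghostBubble λ λ′ z` (`= S = T∕3`) at every `z` (no `z ≠ 0` needed: an identity of closed forms). -/
theorem ghostLoop_eq (lam lam' : Idx) (x : E4) : ghostLoop lam lam' x = ghostBubble lam lam' x := by
  unfold ghostLoop
  have h : ∀ i i' : Fin 2, ∀ κ κ' : Idx, ghostGerm lam κ i * ghostGerm lam' κ' i' * legWx x i i' κ κ'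
      = (sgn i * sgn i') * (δ lam κ * δ lam' κ' * legWx x i i' κ κ') := by
    intro i i' κ κ'; simp only [ghostGerm]; ring
  simp_rw [h]
  simp only [← Finset.mul_sum]
  simp_rw [sum_δδ_F]
  simp only [Fin.sum_univ_two, legWx, sgn_vals.1, sgn_vals.2, Fin.isValue, if_true, one_ne_zero, zero_ne_one, if_false]
  rw [ghostBubble, scalarBubble, hessInvQuartic_eq_legs]
  ring

/-- [folklore] **GLUON + GHOST = THE BACKGROUND-FIELD BUBBLE**: `¼·bubble bfGerm bfGerm + ghostLoop = bfBubble` (`= 4T − S = (11∕3)·T`, the SUM printed as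
Dunne–Rius (14) at `d = 4` — `BubbleTransfer.bfBubble`). -/
theorem quarter_bubble_add_ghost (lam lam' : Idx) {x : E4} (hx : x ≠ 0) :
    (1 / 4 : ℝ) * bubble bfGerm bfGerm lam lam' x + ghostLoop lam lam' x = bfBubble lam lam' x := by
  rw [quarter_bubble_bfGerm lam lam' hx, ghostLoop_eq, bfBubble]

/-- [folklore] With colour `C_A = N` and legs `c₄ℓ₀`: `−N·c₄²·(¼·bubble + ghostLoop) = piOmega N` (Dunne–Rius orientation, by `rfl` of `piOmega`), and in
Bałaban's orientation∕basis (an3's dictionary (D3) `E = −Ω`, (D4) `×2N`): `2N·N·c₄²·(¼·bubble + ghostLoop) = piBal N = kappaBal N · T`. -/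
theorem germ_value_eq_piBal (N : ℝ) (lam lam' : Idx) {x : E4} (hx : x ≠ 0) :
    2 * N * (N * c4 ^ 2 * ((1 / 4 : ℝ) * bubble bfGerm bfGerm lam lam' x + ghostLoop lam lam' x)) = kappaBal N * transverse lam lam' x := by
  rw [quarter_bubble_add_ghost lam lam' hx, ← piBal_eq, piBal, piOmega]; ring

/-- [folklore] **JUNCTION WITH AN3'S REALISED TABLE** (`SquareTable.contBubble_bf_eq_bfBubble`): for `λ ≠ λ′`, `z ≠ 0`,
`2N²c₄²·(¼·bubble bfGerm bfGerm + ghostLoop) = contBubble univ (bfCoeff N) (bfP h) (bfQ h) z` — the continuum bubble of an3's table with its LABELLED sector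
coefficients `8N²` (square) and `−2N²` (ghost shape) IS the germ bubble: `8N² = 2N²·4` from the gluon's `4T`, `−2N² = 2N²·(−2 + 1)` from gluon `−2S` + ghost `+S`. -/
theorem germ_value_eq_contBubble_bf (N : ℝ) {lam lam' : Idx} (h : lam ≠ lam') {x : E4} (hx : x ≠ 0) :
    2 * N ^ 2 * c4 ^ 2 * ((1 / 4 : ℝ) * bubble bfGerm bfGerm lam lam' x + ghostLoop lam lam' x) =
      contBubble Finset.univ (bfCoeff N) (bfP h) (bfQ h) x := by
  rw [quarter_bubble_add_ghost lam lam' hx, contBubble_bf_eq_bfBubble h N hx]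

/-- [folklore] the sector split: the GLUON germ loop alone = square sector at `8N²` (on `T`) + scalar-bubble shape at `−4N²`; the GHOST loop adds `+2N²·S`. -/
theorem germ_sectors (N : ℝ) (lam lam' : Idx) {x : E4} (hx : x ≠ 0) :
    2 * N ^ 2 * c4 ^ 2 * ((1 / 4 : ℝ) * bubble bfGerm bfGerm lam lam' x) =
        8 * N ^ 2 * c4 ^ 2 * transverse lam lam' x - 4 * N ^ 2 * c4 ^ 2 * scalarBubble lam lam' x ∧
      2 * N ^ 2 * c4 ^ 2 * ghostLoop lam lam' x = 2 * N ^ 2 * c4 ^ 2 * scalarBubble lam lam' x := by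
  refine ⟨?_, ?_⟩
  · rw [quarter_bubble_bfGerm lam lam' hx, gluonBubble]; ring
  · rw [ghostLoop_eq, ghostBubble]

/-- [folklore] **`hval` FROM THE GERMS**: `x_λ x_{λ′} · 2N²c₄²·(¼·bubble + ghostLoop) = leadingIntegrand (kappaBal N) λ λ′ x` (`λ ≠ λ′`, `x ≠ 0`) — the value
binder of `ComposedRoad.oneLoopDrift_of_composedLegInterfacePow` with Bałaban's normalised constant `kappaBal N = 11N²∕(24π⁴)`, read off the vertex germs. -/
theorem germ_hval (N : ℝ) {lam lam' : Idx} (h : lam ≠ lam') {x : E4} (hx : x ≠ 0) :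
    x lam * x lam' * (2 * N ^ 2 * c4 ^ 2 * ((1 / 4 : ℝ) * bubble bfGerm bfGerm lam lam' x + ghostLoop lam lam' x)) =
      leadingIntegrand (kappaBal N) lam lam' x := by
  rw [germ_value_eq_contBubble_bf N h hx]
  exact hval_bf h N x hx

/-! ## §6 LOCATED TIGHTNESS: the slice germ cannot be dropped or re-weighted -/

/-- [folklore] `Σ_κ (∂_κℓ₀)²` in closed form inside the family value: **`¼·bubble (famGerm c s) = covFamily (−20c² − 20cs) (44c² + 32cs + 4s²)`**. -/
theorem quarter_bubble_fam (c s : ℝ) (lam lam' : Idx) {x : E4} (hx : x ≠ 0) :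
    (1 / 4 : ℝ) * bubble (famGerm c s) (famGerm c s) lam lam' x =
      covFamily (-(20 * c ^ 2) - 20 * c * s) (44 * c ^ 2 + 32 * c * s + 4 * s ^ 2) lam lam' x := by
  have hr : r2 x ≠ 0 := (r2_pos hx).ne'
  rw [bubble_fam c s lam lam' hx, sum_d1InvSq_sq hx, covFamily, invSq, hessInvSq, d1InvSq, d1InvSq]
  unfold δ; split_ifs <;> field_simp <;> ring

/-- [folklore] In particular the Yang–Mills germ ALONE (`s = 0`): `¼·bubble ymGerm ymGerm = covFamily (−20) 44 = (11∕6)·T + 2·δ_{λλ′}∕r2³` — NOT transverse. -/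
theorem quarter_bubble_ymGerm (lam lam' : Idx) {x : E4} (hx : x ≠ 0) :
    (1 / 4 : ℝ) * bubble ymGerm ymGerm lam lam' x = (11 / 6 : ℝ) * transverse lam lam' x + (if lam = lam' then 2 / r2 x ^ 3 else 0) := by
  rw [ymGerm_eq_fam, quarter_bubble_fam 1 0 lam lam' hx, covFamily, transverse_eq]
  split_ifs <;> ring

/-- [folklore] **THE SLICE WEIGHT IS FORCED**: the family value `covFamily (−20c² − 20cs) (44c² + 32cs + 4s²)` is divergence-free on `ℝ⁴ ∖ 0`
(`TransverseStructure.divFree_iff`: `b = −2a`, i.e. `4(c − s)² = 0`) **iff `s = c`** — one-loop transversality at separated points holds exactly for the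
Feynman-slice weight that `bfGerm` carries (H2-DESIGN §5 «the slice choice lattice BF-Feynman is what makes (H2-b)'s value an3's table value»). -/
theorem fam_divFree_iff (c s : ℝ) :
    (∀ x : E4, x ≠ 0 → ∀ ν : Fin 4, ∑ μ, divTerm (-(20 * c ^ 2) - 20 * c * s) (44 * c ^ 2 + 32 * c * s + 4 * s ^ 2) μ ν x = 0) ↔ s = c := by
  rw [divFree_iff]
  constructor
  · intro h
    have h' : (s - c) ^ 2 = 0 := by linear_combination (1 / 4 : ℝ) * h
    have h'' : s - c = 0 := (pow_eq_zero_iff two_ne_zero).mp h'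
    linarith
  · rintro rfl; ring

/-- [folklore] … and at `s = c` the value is `c²` times the background-Feynman one: `¼·bubble (famGerm c c) = c²·gluonBubble` (`= c²·(10∕3)·T`) — so with
H2-G's `germ(V*) = cQ·ymGerm` and the slice's `cQ·sliceGerm` the germ bubble scales by `cQ²` (canonically `cQ = 1`, `PerfectSymbol166.W166lim_zero`). -/
theorem quarter_bubble_fam_diag (c : ℝ) (lam lam' : Idx) {x : E4} (hx : x ≠ 0) :
    (1 / 4 : ℝ) * bubble (famGerm c c) (famGerm c c) lam lam' x = c ^ 2 * gluonBubble lam lam' x := by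
  rw [bubble_fam c c lam lam' hx, gluonBubble, scalarBubble, transverse_eq_legs lam lam' hx, hessInvQuartic_eq_legs]
  unfold δ; split_ifs <;> ring

end

end Summit.QuantumFields.BalabanUV.Beta.FP.BubbleGermValue
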